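import Mathlib
import HarnessLib
import Summits.HubbardSuperconductivity.HubbardSuperconductivity.Theorems.KLProgrammeKLRegimeEngineTowerBlockIncrWtKitCarrier
import Summits.HubbardSuperconductivity.HubbardSuperconductivity.Theorems.KLProgrammeKLRegimeEngineTowerBlockIncrWtPowAtKit
import Summits.HubbardSuperconductivity.HubbardSuperconductivity.Theorems.KLProgrammeKLRegimeEngineTowerModelDefsWtPowAt

/-!
# Route `KLProgramme` — crux K3 ENGINE (stmt-HubbardSuperconductivity-20437 `KLRegimeEngineV17F2`), stub (b) / E1 interface (E2) in-tower route and located risk #17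
# «(C2)-MOMENTS»: THE DEGREE-`Dw` MODEL Hstep ON THE CARRIERS — `klTowerBornWtPowAt … d k j Dw (2(q+1))` bounded by the kit step in the measured degree-`Dw` sizes
# `klTowerMeasWtPowAt`; the power-`Dw` twin of `…EngineTowerBlockIncrWtKitCarrier` §1–§3
# (recipe «(E2)-POW3-TRACK» item T5c «carrier kit»; pen g27 (R472) carriers/link GO; cell gate-hubbard-kl, seat hubbard-kl-k3c3-p2 g19)

Exactly as `klTowerBornWtAt_le_kit` (degree 1): the input-size hypotheses of `klWtPinnedSumPow_klTowerIncr_le_kit (j Dw)` (…TowerBlockIncrWtPowAtKit) are served by the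
measured array `klTowerMeasWtPowAt` (✓ …TowerModelDefsWtPowAt, p728438), the output is taken to its supremum `klTowerBornWtPowAt`:

* §1 `klTowerMeasWtPowAt_zero`, `klTowerBornWtPowAt_zero` (degree `0`: empty suprema);
* §2 `towerInputMajorant_of_klTowerMeasWtPowAt`, `towerInputSizesPow_eq` (the carrier majorant and its absolute kit sizes `ε·klTowerMeasWtPowAt … (2m′)`);
* §3 **`klTowerBornWtPowAt_le_kit (j Dw)`** — `klTowerBornWtPowAt … d k j Dw (2(q+1)) ≤ ε^{2q+1}·cr·cc^{2q+1}·(towerFO D κ² N (q+1) + Σ e·Φ^{n−1}·ψ^{q+1}·towerS … + tail)`,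
  `N m′ := ε·klTowerMeasWtPowAt … d k j Dw (2m′)`, under the KIT guard on `N`.
Compositions of landed theorems; block constants (`κ`, degree-`Dw` weighted `α`, `cr/cc`) are HYPOTHESES; nothing asserts (E2), (X).3, any stub, K3 or superconductivity.
References: BGM 2006 §2.7 (2.71a), §2.8 (2.77), (2.81)–(2.84), §3 (3.2)–(3.8) [cite: BenfattoGiulianiMastropietro2006].
-/

noncomputable section

namespace Summit.HubbardSuperconductivity.HubbardSuperconductivity.Theorems.EngineV8

set_option linter.dupNamespace false -- summit = problem name (single-conjunct summit), D-0017

open Real Finset Literature.MathematicalPhysics.QuantumLattice Literature.Probability.LatticeModels GrassmannAlgebra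
open Summit.HubbardSuperconductivity.HubbardSuperconductivity.Theorems.KLProgrammeLegKernels
open Summit.HubbardSuperconductivity.HubbardSuperconductivity.Theorems.KLRegimeSplit
open Summit.HubbardSuperconductivity.HubbardSuperconductivity.Theorems.KLRegimeWick
open Summit.HubbardSuperconductivity.HubbardSuperconductivity.Theorems.TwoPointAssembly
open Literature.Probability.LatticeModels.BattleFederbush

variable {L M : ℕ} [NeZero L]

/-! ## §1 Degree `0`: the carriers are empty suprema -/

/-- The measured weighted carrier vanishes in degree `0` (no leg to pin: `Fin 0 × _` is empty). -/
theorem klTowerMeasWtPowAt_zero (β U μ : ℝ) (K : TrigPolyC4v) (d k j Dw : ℕ) : klTowerMeasWtPowAt L M β U μ K d k j Dw 0 = 0 := by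
  unfold klTowerMeasWtPowAt
  haveI : IsEmpty (Fin 0 × (SpaceTimeIdx L M × SectorLeg (sectorCount (d * k - 1)))) := by infer_instance
  rw [Real.iSup_of_isEmpty]

/-- The born weighted carrier vanishes in degree `0`. -/
theorem klTowerBornWtPowAt_zero (β U μ : ℝ) (K : TrigPolyC4v) (d k j Dw : ℕ) : klTowerBornWtPowAt L M β U μ K d k j Dw 0 = 0 := by
  unfold klTowerBornWtPowAt
  haveI : IsEmpty (Fin 0 × (SpaceTimeIdx L M × SectorLeg (sectorCount (d * k)))) := by infer_instance
  rw [Real.iSup_of_isEmpty]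

/-! ## §2 The carrier majorant of the input pinned sums -/

section Carrier

variable [NeZero M]

/-- **The carrier majorant satisfies p578846's `hB`**: every un-normalised rate-`j` weighted pinned sum of the input `𝒱_{dk}` at `F_{dk−1}` in degree `2m′` is at most
`klTowerMeasWtAt … d k j (2m′) / ε^{2m′−1}`. -/
theorem towerInputMajorant_of_klTowerMeasWtPowAt {β : ℝ} (hβ : 0 < β) (U μ : ℝ) (K : TrigPolyC4v) (d k j Dw m' : ℕ) (t : Fin (2 * m'))
    (w : SpaceTimeIdx L M × SectorLeg (sectorCount (d * k - 1))) :
    ∑ Y ∈ univ.filter (fun Y : Fin (2 * m') → SpaceTimeIdx L M × SectorLeg (sectorCount (d * k - 1)) => Y t = w),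
        klScaleWtPow L M β j Dw ((univ.image Y).image (latticeLegPos (2 * (2 * M)))) *
          ‖kernel ℂ (ExteriorAlgebra.map (Matrix.toLin' (sectorAnalysisMatrix L M β (klAnisoFamily L M β μ K klE0 (d * k - 1))))
            (klTowerInput L M β U μ K d k)) (2 * m') Y‖ ≤
      klTowerMeasWtPowAt L M β U μ K d k j Dw (2 * m') / imagTimeWeight β M ^ (2 * m' - 1) := by
  have hε := imagTimeWeight_pos_of_pos (M := M) hβ
  rw [le_div_iff₀ (pow_pos hε _), mul_comm]
  exact klWtPinnedSumPow_le_klTowerMeasWtPowAt β U μ K d k j Dw (2 * m') t w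

/-- The absolute kit sizes of the carrier majorant: `ε^{2m′}·(klTowerMeasWtAt … (2m′)/ε^{2m′−1}) = ε·klTowerMeasWtAt … (2m′)` (degree `0` by `klTowerMeasWtPowAt_zero`). -/
theorem towerInputSizesPow_eq {β : ℝ} (hβ : 0 < β) (U μ : ℝ) (K : TrigPolyC4v) (d k j Dw : ℕ) :
    (fun m' : ℕ => imagTimeWeight β M ^ (2 * m') * (klTowerMeasWtPowAt L M β U μ K d k j Dw (2 * m') / imagTimeWeight β M ^ (2 * m' - 1))) =
      fun m' : ℕ => imagTimeWeight β M * klTowerMeasWtPowAt L M β U μ K d k j Dw (2 * m') := by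
  have hε := imagTimeWeight_pos_of_pos (M := M) hβ
  funext m'
  rcases Nat.eq_zero_or_pos m' with rfl | hm
  · simp [klTowerMeasWtPowAt_zero]
  · have h : imagTimeWeight β M ^ (2 * m') = imagTimeWeight β M ^ (2 * m' - 1) * imagTimeWeight β M := by
      rw [← pow_succ]; congr 1; omega
    rw [h]; field_simp

/-! ## §3 The composed model Hstep on the carriers — binder version -/

/-- **THE MODEL Hstep IN KIT FORM ON THE CARRIERS (weighted track).**  Binders as `klWtPinnedSumPow_klTowerIncr_le_kit` (p578846's block data at rate `j`) WITHOUT the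
input-size hypotheses (served by the carrier `klTowerMeasWtAt`), kit guard on the sizes `N m′ := ε·klTowerMeasWtAt … d k j (2m′)`:
`klTowerBornWtAt … d k j (2(q+1)) ≤ ε^{2q+1}·cr·cc^{2q+1}·(towerFO D κ² N (q+1) + Σ_{n∈Icc 2 (N₀−1)} e·Φ^{n−1}·ψ^{q+1}·towerS D τ N n (q+1) +
ψ^{q+1}·e·towerV D τ N·(Φ·towerV D τ N)^{N₀−1}/(1 − Φ·towerV D τ N))`, `τ = (e²(κ+ρ))²`, `Φ = eα/κ²`, `ψ = ρ⁻²`. -/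
theorem klTowerBornWtPowAt_le_kit {β : ℝ} (hβ : 0 < β) (U μ : ℝ) (K : TrigPolyC4v) {d k : ℕ} (j Dw : ℕ) (hd : 1 ≤ d) (hk : 1 ≤ k)
    (hZ : hubbardEffPartitionFnCT L M β U μ 0 K (klScale klE0 (d * k)) ≠ 0)
    {κ : ℝ} (hκ : 0 < κ)
    (hGB : IsGramBoundedR ((sectorSubMatrix L M β (bgmFatMultiplier L M klE0 β (nambuXiCT L μ K) (d * k - 1))).transpose *
      hubbardCovSliceCT L M β μ 0 K (klScale klE0 (d * (k + 1))) (klScale klE0 (d * k)) *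
        sectorSubMatrix L M β (bgmFatMultiplier L M klE0 β (nambuXiCT L μ K) (d * k - 1))) κ)
    {α : ℝ} (hα : 0 < α)
    (hrow : ∀ X, ∑ Y, ‖((sectorSubMatrix L M β (bgmFatMultiplier L M klE0 β (nambuXiCT L μ K) (d * k - 1))).transpose *
        hubbardCovSliceCT L M β μ 0 K (klScale klE0 (d * (k + 1))) (klScale klE0 (d * k)) *
          sectorSubMatrix L M β (bgmFatMultiplier L M klE0 β (nambuXiCT L μ K) (d * k - 1))) X Y‖ *
        klScaleWtPow L M β j Dw {latticeLegPos (2 * (2 * M)) X, latticeLegPos (2 * (2 * M)) Y} ≤ α)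
    (hcol : ∀ Y, ∑ X, ‖((sectorSubMatrix L M β (bgmFatMultiplier L M klE0 β (nambuXiCT L μ K) (d * k - 1))).transpose *
        hubbardCovSliceCT L M β μ 0 K (klScale klE0 (d * (k + 1))) (klScale klE0 (d * k)) *
          sectorSubMatrix L M β (bgmFatMultiplier L M klE0 β (nambuXiCT L μ K) (d * k - 1))) X Y‖ *
        klScaleWtPow L M β j Dw {latticeLegPos (2 * (2 * M)) X, latticeLegPos (2 * (2 * M)) Y} ≤ α)
    {ρ : ℝ} (hρ : 0 < ρ) {D : ℕ} (hD : Fintype.card (SpaceTimeIdx L M × SectorLeg (sectorCount (d * k - 1))) / 2 ≤ D)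
    (hguard : Real.exp 1 * α / κ ^ 2 *
      towerV D ((Real.exp 2 * (κ + ρ)) ^ 2) (fun m' => imagTimeWeight β M * klTowerMeasWtPowAt L M β U μ K d k j Dw (2 * m')) < 1)
    {cr cc : ℝ} (hcr0 : 0 ≤ cr) (hcc0 : 0 ≤ cc)
    (hrow' : ∀ X'', ∑ X', ‖(sectorAnalysisMatrix L M β (klAnisoFamily L M β μ K klE0 (d * k)) *
        sectorSubMatrix L M β (bgmFatMultiplier L M klE0 β (nambuXiCT L μ K) (d * k - 1))) X'' X'‖ *
        klScaleWtPow L M β j Dw {latticeLegPos (2 * (2 * M)) X'', latticeLegPos (2 * (2 * M)) X'} ≤ cr)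
    (hcol' : ∀ X', ∑ X'', ‖(sectorAnalysisMatrix L M β (klAnisoFamily L M β μ K klE0 (d * k)) *
        sectorSubMatrix L M β (bgmFatMultiplier L M klE0 β (nambuXiCT L μ K) (d * k - 1))) X'' X'‖ *
        klScaleWtPow L M β j Dw {latticeLegPos (2 * (2 * M)) X'', latticeLegPos (2 * (2 * M)) X'} ≤ cc)
    {N₀ : ℕ} (hN₀ : 2 ≤ N₀) (q : ℕ) :
    klTowerBornWtPowAt L M β U μ K d k j Dw (2 * (q + 1)) ≤
      imagTimeWeight β M ^ (2 * q + 1) *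
        (cr * cc ^ (2 * q + 1) *
          (towerFO D (κ ^ 2) (fun m' => imagTimeWeight β M * klTowerMeasWtPowAt L M β U μ K d k j Dw (2 * m')) (q + 1) +
            ∑ n ∈ Icc 2 (N₀ - 1), Real.exp 1 * (Real.exp 1 * α / κ ^ 2) ^ (n - 1) * (ρ⁻¹ ^ 2) ^ (q + 1) *
              towerS D ((Real.exp 2 * (κ + ρ)) ^ 2) (fun m' => imagTimeWeight β M * klTowerMeasWtPowAt L M β U μ K d k j Dw (2 * m')) n (q + 1) +
            (ρ⁻¹ ^ 2) ^ (q + 1) * Real.exp 1 *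
              towerV D ((Real.exp 2 * (κ + ρ)) ^ 2) (fun m' => imagTimeWeight β M * klTowerMeasWtPowAt L M β U μ K d k j Dw (2 * m')) *
              (Real.exp 1 * α / κ ^ 2 *
                towerV D ((Real.exp 2 * (κ + ρ)) ^ 2) (fun m' => imagTimeWeight β M * klTowerMeasWtPowAt L M β U μ K d k j Dw (2 * m'))) ^ (N₀ - 1) /
              (1 - Real.exp 1 * α / κ ^ 2 *
                towerV D ((Real.exp 2 * (κ + ρ)) ^ 2) (fun m' => imagTimeWeight β M * klTowerMeasWtPowAt L M β U μ K d k j Dw (2 * m'))))) := by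
  have hε := imagTimeWeight_pos_of_pos (M := M) hβ
  set B : ℕ → ℝ := fun m' => klTowerMeasWtPowAt L M β U μ K d k j Dw (2 * m') / imagTimeWeight β M ^ (2 * m' - 1) with hBdef
  have hB0 : ∀ m', 0 ≤ B m' := fun m' => div_nonneg (klTowerMeasWtPowAt_nonneg hβ.le U μ K d k j Dw _) (pow_nonneg hε.le _)
  have hB00 : B 0 = 0 := by simp [hBdef, klTowerMeasWtPowAt_zero]
  have hB : ∀ (m' : ℕ) (t : Fin (2 * m')) (w : SpaceTimeIdx L M × SectorLeg (sectorCount (d * k - 1))),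
      ∑ Y ∈ univ.filter (fun Y : Fin (2 * m') → SpaceTimeIdx L M × SectorLeg (sectorCount (d * k - 1)) => Y t = w),
        klScaleWtPow L M β j Dw ((univ.image Y).image (latticeLegPos (2 * (2 * M)))) *
          ‖kernel ℂ (ExteriorAlgebra.map (Matrix.toLin' (sectorAnalysisMatrix L M β (klAnisoFamily L M β μ K klE0 (d * k - 1))))
            (klTowerInput L M β U μ K d k)) (2 * m') Y‖ ≤ B m' :=
    fun m' t w => towerInputMajorant_of_klTowerMeasWtPowAt hβ U μ K d k j Dw m' t w
  have hNeq := towerInputSizesPow_eq (L := L) (M := M) hβ U μ K d k j Dw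
  -- the kit guard in `B`-form
  have hguard' : Real.exp 1 * α / κ ^ 2 *
      towerV D ((Real.exp 2 * (κ + ρ)) ^ 2) (fun m' => imagTimeWeight β M ^ (2 * m') * B m') < 1 := by
    rw [hBdef]; rw [hNeq]; exact hguard
  -- pin by pin, then the supremum
  unfold klTowerBornWtPowAt
  rcases isEmpty_or_nonempty (Fin (2 * (q + 1)) × (SpaceTimeIdx L M × SectorLeg (sectorCount (d * k)))) with h | h
  · rw [Real.iSup_of_isEmpty]
    have hV0 : 0 ≤ towerV D ((Real.exp 2 * (κ + ρ)) ^ 2) (fun m' => imagTimeWeight β M * klTowerMeasWtPowAt L M β U μ K d k j Dw (2 * m')) :=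
      towerV_nonneg (by positivity) (fun m' => mul_nonneg hε.le (klTowerMeasWtPowAt_nonneg hβ.le U μ K d k j Dw _))
    have hFO0 : 0 ≤ towerFO D (κ ^ 2) (fun m' => imagTimeWeight β M * klTowerMeasWtPowAt L M β U μ K d k j Dw (2 * m')) (q + 1) :=
      towerFO_nonneg (sq_nonneg κ) (fun m' => mul_nonneg hε.le (klTowerMeasWtPowAt_nonneg hβ.le U μ K d k j Dw _)) _
    have hS0 : ∀ n, 0 ≤ towerS D ((Real.exp 2 * (κ + ρ)) ^ 2)
        (fun m' => imagTimeWeight β M * klTowerMeasWtPowAt L M β U μ K d k j Dw (2 * m')) n (q + 1) := fun n =>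
      towerS_nonneg (by positivity) (fun m' => mul_nonneg hε.le (klTowerMeasWtPowAt_nonneg hβ.le U μ K d k j Dw _)) _ _
    have h1 : 0 ≤ 1 - Real.exp 1 * α / κ ^ 2 *
        towerV D ((Real.exp 2 * (κ + ρ)) ^ 2) (fun m' => imagTimeWeight β M * klTowerMeasWtPowAt L M β U μ K d k j Dw (2 * m')) :=
      sub_nonneg.2 hguard.le
    have hsum : 0 ≤ ∑ n ∈ Icc 2 (N₀ - 1), Real.exp 1 * (Real.exp 1 * α / κ ^ 2) ^ (n - 1) * (ρ⁻¹ ^ 2) ^ (q + 1) *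
        towerS D ((Real.exp 2 * (κ + ρ)) ^ 2) (fun m' => imagTimeWeight β M * klTowerMeasWtPowAt L M β U μ K d k j Dw (2 * m')) n (q + 1) :=
      sum_nonneg fun n _ => by have := hS0 n; positivity
    positivity
  · refine ciSup_le fun iw => ?_
    have h := klWtPinnedSumPow_klTowerIncr_le_kit (L := L) (M := M) hβ U μ K j Dw hd hk le_rfl hZ hκ hGB B hB0 hB00 hB hα hrow hcol hρ hD hguard'
      hcr0 hcc0 hrow' hcol' hN₀ q iw.1 iw.2
    rw [hBdef] at h; rw [hNeq] at h
    exact h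

end Carrier

end Summit.HubbardSuperconductivity.HubbardSuperconductivity.Theorems.EngineV8

end
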